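import Summits.QuantumFields.YangMills.Theorems.BalabanUVNodesN14TargetOfBinderAndClassLawTV
import Mathlib.MeasureTheory.Integral.IntervalIntegral.FundThmCalculus

/-!
# DAG node N14 (NE1′) → N19′ ∕ N20 — dag-n20-w4's CHARACTERISATION RE-KEYED: in MGF form, `∃ six dials HybridNE7` ⟺ [summable per-set class-law TV < 1] ∧
# [N14's binder, CLASS-AVERAGED AND SOURCE-INTEGRATED, summable] — nothing else of the Target conjunct survives

Cell `pub-ymgap` (HUMAN RULING D-0062, Track A), WIDTH SEAT `pub-ymgap-dag-n14-w2` (NODE n14 = NE1′), generation 6, FILE 3; `--kind proof --supports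
stmt-QuantumFields-20544 --as helper` (K3⁷; helper, NOT a discharge; count-neutral).  THEOREMS ONLY (0 `def`, 0 `instance`, 0 `sorry`).  Imports this seat's FILE 1
`…N14TargetOfBinderAndClassLawTV` (p612221: `avgMismatch_eq_deriv_sub_transport`, `abs_transport_le`, `tiltedMean_total_eq_avg`, `log_eq_cgf_finsetSum`,
`isFiniteMeasure_finsetSum`; through it NE1′'s `DressedMGFForm` ∕ `TiltedMeanInfluence`, `Spine.NE7.Targets`, dag-n20-w4's p609004) + Mathlib's interval-integral FTC ONLY —
CITED BY NAME; edits nothing.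

WHY.  dag-n20-w4 p609004 `exists_hybridNE7_iff_target_and_classLawTV`: at one key, `(∃ Bad W shA shB Wsh δ, HybridNE7 …) ⟺ (∃ δ, NE7.Target vol l₀ δ Z) ∧ (summable per-set
class-law TV radius < 1)`.  FILE 1 showed (MGF form, `A K t τ = mgf (F K) (ν K τ) t`) that the source derivative of `log Z_{K+1} − log Z_K` is N14's mismatch AVERAGED under run A's
dressed class law plus a transport term `≤ 2B·ρ_K`.  Integrating (FTC for the cumulant generating functions of bounded observables under finite measures) gives the EXACT
re-keying of the iff (§5 ★★★ `exists_hybridNE7_iff_classLawTV_and_integral_avgMismatch`):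
  `(∃ six dials, HybridNE7) ⟺ (∃ ρ summable, 0 ≤ ρ_K < 1, per-set class-law TV ≤ ρ_K) ∧ (∃ r summable, ∀ K, ∀ |t| ≤ l₀, |∫₀ᵗ Σ_τ p_s(τ)·(m′_s(τ) − m_s(τ)) ds| ≤ r_K)`
(`p_s = A K s ∕ Σ_T A K s` run A's dressed class law, `m, m′` the two runs' class-wise source-tilted means of the observable = NODE N14's OBJECTS).  The second conjunct is the
summable smallness of N14's binder `TiltedMeanMatching` in class-averaged, source-integrated form; FILE 1's `exists_hybridNE7_of_binder_classLawTV` is the sufficient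
instance `r_K = l₀(η_K + 2B·W_K)` (good classes + bad weight), and NO bad-class split is needed in the iff (the average runs over all classes).  Contrast the CLASS-WISE
converse in the tree (dag-n19-e `…N19TiltedPriceClosedWindow.tiltedMeanMatching_of_core_closedWindow`: MGF-form cores with `Core δ` ⇒ `TiltedMeanMatching η` at a `vol·δ_K·log²`-type
rate whose summability is NOT claimed): the class-AVERAGED, source-INTEGRATED form is the one in which the equivalence is exact and summability is kept both ways.
* §1 [folklore] continuity in the source: `continuous_mgf_of_abs_le` · `continuous_tiltedMean` · `continuous_classLaw` · `continuous_avgMismatch` · `continuous_transport`.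
* §2 [folklore] FTC: `hasDerivAt_cgf_sub_cgf` · ★ `integral_avgMismatch_eq` (`∫₀ᵗ avgM = (cgf_B − cgf_A)(t) − (cgf_B − cgf_A)(0) − ∫₀ᵗ transport`) · `abs_integral_transport_le`.
* §3 NECESSITY ★★ `integral_avgMismatch_le_of_hybridNE7` (ANY six dials ⇒ `|∫₀ᵗ avgM_K| ≤ 2·vol·δ′_K + 2B·l₀·ρ_K`, ρ, δ′ summable).
* §4 SUFFICIENCY ★★ `matchingModConstants_of_integral_avgMismatch_of_classLawTV` · `exists_hybridNE7_of_integral_avgMismatch_of_classLawTV` (p609004 BY NAME).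
* §5 ★★★ the iff.

HONEST FRAMING.  [folklore] one-variable calculus + by-name composition on hypothesis SHAPES; the class-law TV radius and N14's averaged binder are HYPOTHESES produced by nobody
(no live Stage-13 tuple exhibited, K0⁷ OPEN); proves NO estimate of the programme; nothing of Bałaban's asserted or instantiated; NE1′ ∕ NE7 ∕ NE7b NOT PRINTED as two-run
statements for d = 4, NOT proved; N14 ∕ N19 ∕ N20 NOT discharged; K3⁷ OPEN, skeleton v5 untouched; counts UNMOVED.  One finite 𝕋⁴ programme at fixed ε; R4 closes only the
CONDITIONAL finite-𝕋⁴ rung `BalabanLadder.UV` — NOT ℝ⁴, NOT OS, NOT the Yang–Mills mass gap (Clay), which is NOT proved by any of this.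
-/

noncomputable section

open MeasureTheory ProbabilityTheory Finset intervalIntegral

namespace YMDAG.N14.HybridIffClassLawTVAndBinder

open Literature.MathematicalPhysics.QuantumFieldTheory.Balaban1983to89
open Literature.MathematicalPhysics.QuantumFieldTheory.Balaban1983to89.T4CauchySum (MatchingModConstants)
open Literature.MathematicalPhysics.QuantumFieldTheory.Balaban1983to89.T4MatchingAssembly (HybridNE7)
open Summit.QuantumFields.BalabanUV.T4Continuum.NE1p.DressedMGFForm
open Summit.QuantumFields.BalabanUV.T4Continuum.NE1p.TiltedMeanInfluence (hasDerivAt_tiltedMean abs_tiltedMean_le)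
open Summit.QuantumFields.BalabanUV.T4Continuum.Spine.NE7 (Target target_of_hybridNE7)
open Summit.QuantumFields.YangMills.BalabanUVNodes.N20HybridClassLawCharacterisation
  (exists_hybridNE7_of_target_of_classLawTV exists_tvRadius_of_hybridNE7)
open YMDAG.N14.TargetOfBinderAndClassLawTV

/-! ## §1 Continuity in the source -/

section Continuity

variable {Ω : Type*} {mΩ : MeasurableSpace Ω} {F : Ω → ℝ} {B : ℝ}

/-- The MGF of a bounded observable under a finite measure is continuous in the source (Mathlib `hasDerivAt_mgf` on `integrableExpSet = ℝ`). [folklore] -/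
theorem continuous_mgf_of_abs_le (ν : Measure Ω) [IsFiniteMeasure ν] (hFm : Measurable F) (hF : ∀ ω, |F ω| ≤ B) :
    Continuous fun s => mgf F ν s :=
  continuous_iff_continuousAt.mpr fun s =>
    (hasDerivAt_mgf (T4GenFunBounds.mem_interior_integrableExpSet hFm.aemeasurable (ae_of_all _ hF) s)).continuousAt

/-- N14's tilted mean is continuous in the source (NE1′'s `hasDerivAt_tiltedMean`). [folklore] -/
theorem continuous_tiltedMean (ν : Measure Ω) [IsFiniteMeasure ν] (hFm : Measurable F) (hF : ∀ ω, |F ω| ≤ B) :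
    Continuous fun s => tiltedMean F ν s :=
  continuous_iff_continuousAt.mpr fun s => (hasDerivAt_tiltedMean (ν := ν) hFm hF s).continuousAt

end Continuity

section AtForms

variable {ι : Type*} {Ω Ω' : ℕ → Type*} [∀ K, MeasurableSpace (Ω K)] [∀ K, MeasurableSpace (Ω' K)]
  {l₀ vol B : ℝ} {T : ℕ → Finset ι}
  {F : ∀ K, Ω K → ℝ} {ν : ∀ K, ι → Measure (Ω K)} {F' : ∀ K, Ω' K → ℝ} {ν' : ∀ K, ι → Measure (Ω' K)}
  {A Bf : ℕ → ℝ → ι → ℝ} {ρ r : ℕ → ℝ} {Z : ℕ → ℝ → ℝ}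

/-- Every dressed class total `s ↦ A K s τ` is continuous (it is an MGF). [folklore] -/
theorem continuous_dressed (hA : MGFForm B T F ν A) (K : ℕ) {τ : ι} (hτ : τ ∈ T K) : Continuous fun s => A K s τ := by
  haveI := hA.finite K τ hτ
  have : (fun s => A K s τ) = fun s => mgf (F K) (ν K τ) s := funext fun s => hA.repr K s τ hτ
  rw [this]; exact continuous_mgf_of_abs_le (ν K τ) (hA.meas K) (hA.bound K)

/-- Run A's dressed CLASS LAW `s ↦ A K s τ ∕ Σ_T A K s` is continuous in the source (positive totals). [folklore] -/
theorem continuous_classLaw (hA : MGFForm B T F ν A) (K : ℕ) (hZA : ∀ s : ℝ, 0 < ∑ σ ∈ T K, A K s σ) {τ : ι} (hτ : τ ∈ T K) :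
    Continuous fun s => A K s τ / ∑ σ ∈ T K, A K s σ :=
  (continuous_dressed hA K hτ).div (continuous_finsetSum _ fun _ hσ => continuous_dressed hA K hσ) fun s => (hZA s).ne'

/-- **THE CLASS-AVERAGED N14 MISMATCH IS CONTINUOUS IN THE SOURCE**: `s ↦ Σ_T p_s(τ)·(m′_s(τ) − m_s(τ))`. [folklore] -/
theorem continuous_avgMismatch (hA : MGFForm B T F ν A) (hB : MGFForm B T F' ν' Bf) (K : ℕ) (hZA : ∀ s : ℝ, 0 < ∑ σ ∈ T K, A K s σ) :
    Continuous fun s => ∑ τ ∈ T K, A K s τ / (∑ σ ∈ T K, A K s σ) * (tiltedMean (F' K) (ν' K τ) s - tiltedMean (F K) (ν K τ) s) :=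
  continuous_finsetSum _ fun τ hτ => by
    haveI := hA.finite K τ hτ; haveI := hB.finite K τ hτ
    exact (continuous_classLaw hA K hZA hτ).mul
      ((continuous_tiltedMean (ν' K τ) (hB.meas K) (hB.bound K)).sub (continuous_tiltedMean (ν K τ) (hA.meas K) (hA.bound K)))

/-- The class-law TRANSPORT term `s ↦ Σ_T (q_s − p_s)(τ)·m′_s(τ)` is continuous in the source. [folklore] -/
theorem continuous_transport (hA : MGFForm B T F ν A) (hB : MGFForm B T F' ν' Bf) (K : ℕ) (hZA : ∀ s : ℝ, 0 < ∑ σ ∈ T K, A K s σ)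
    (hZB : ∀ s : ℝ, 0 < ∑ σ ∈ T K, Bf K s σ) :
    Continuous fun s => ∑ τ ∈ T K, (Bf K s τ / (∑ σ ∈ T K, Bf K s σ) - A K s τ / (∑ σ ∈ T K, A K s σ)) * tiltedMean (F' K) (ν' K τ) s :=
  continuous_finsetSum _ fun τ hτ => by
    haveI := hB.finite K τ hτ
    exact ((continuous_classLaw hB K hZB hτ).sub (continuous_classLaw hA K hZA hτ)).mul
      (continuous_tiltedMean (ν' K τ) (hB.meas K) (hB.bound K))

/-! ## §2 The fundamental theorem of calculus for `cgf_B − cgf_A` -/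

/-- `s ↦ cgf_B(s) − cgf_A(s)` has derivative the difference of the WHOLE tilted means at every source (NE1′'s `deriv_cgf_eq_tiltedMean`). [folklore] -/
theorem hasDerivAt_cgf_sub_cgf (hA : MGFForm B T F ν A) (hB : MGFForm B T F' ν' Bf) (K : ℕ) (s : ℝ) :
    HasDerivAt (fun s => cgf (F' K) (∑ τ ∈ T K, ν' K τ) s - cgf (F K) (∑ τ ∈ T K, ν K τ) s)
      (tiltedMean (F' K) (∑ τ ∈ T K, ν' K τ) s - tiltedMean (F K) (∑ τ ∈ T K, ν K τ) s) s := by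
  haveI : IsFiniteMeasure (∑ τ ∈ T K, ν K τ) := isFiniteMeasure_finsetSum (T K) (ν K) (hA.finite K)
  haveI : IsFiniteMeasure (∑ τ ∈ T K, ν' K τ) := isFiniteMeasure_finsetSum (T K) (ν' K) (hB.finite K)
  have hdA := (T4GenFunBounds.differentiable_cgf_of_abs_le (μ := ∑ τ ∈ T K, ν K τ) (hA.meas K).aemeasurable
    (ae_of_all _ (hA.bound K)) s).hasDerivAt
  have hdB := (T4GenFunBounds.differentiable_cgf_of_abs_le (μ := ∑ τ ∈ T K, ν' K τ) (hB.meas K).aemeasurable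
    (ae_of_all _ (hB.bound K)) s).hasDerivAt
  rw [deriv_cgf_eq_tiltedMean (hA.meas K) (hA.bound K)] at hdA
  rw [deriv_cgf_eq_tiltedMean (hB.meas K) (hB.bound K)] at hdB
  exact hdB.sub hdA

/-- The difference of the whole tilted means is continuous in the source. [folklore] -/
theorem continuous_tiltedMean_total_sub (hA : MGFForm B T F ν A) (hB : MGFForm B T F' ν' Bf) (K : ℕ) :
    Continuous fun s => tiltedMean (F' K) (∑ τ ∈ T K, ν' K τ) s - tiltedMean (F K) (∑ τ ∈ T K, ν K τ) s := by
  haveI : IsFiniteMeasure (∑ τ ∈ T K, ν K τ) := isFiniteMeasure_finsetSum (T K) (ν K) (hA.finite K)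
  haveI : IsFiniteMeasure (∑ τ ∈ T K, ν' K τ) := isFiniteMeasure_finsetSum (T K) (ν' K) (hB.finite K)
  exact (continuous_tiltedMean _ (hB.meas K) (hB.bound K)).sub (continuous_tiltedMean _ (hA.meas K) (hA.bound K))

/-- ★ **FTC FOR THE CLASS-AVERAGED N14 MISMATCH**: with positive dressed totals,
`∫₀ᵗ Σ_T p_s·(m′_s − m_s) ds = [(cgf_B − cgf_A)(t) − (cgf_B − cgf_A)(0)] − ∫₀ᵗ Σ_T (q_s − p_s)·m′_s ds` (FILE 1's `avgMismatch_eq_deriv_sub_transport` integrated;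
Mathlib `intervalIntegral.integral_eq_sub_of_hasDerivAt`). [folklore] -/
theorem integral_avgMismatch_eq (hA : MGFForm B T F ν A) (hB : MGFForm B T F' ν' Bf) (K : ℕ) (hZA : ∀ s : ℝ, 0 < ∑ σ ∈ T K, A K s σ)
    (hZB : ∀ s : ℝ, 0 < ∑ σ ∈ T K, Bf K s σ) (t : ℝ) :
    ∫ s in (0 : ℝ)..t, ∑ τ ∈ T K, A K s τ / (∑ σ ∈ T K, A K s σ) * (tiltedMean (F' K) (ν' K τ) s - tiltedMean (F K) (ν K τ) s)
      = ((cgf (F' K) (∑ τ ∈ T K, ν' K τ) t - cgf (F K) (∑ τ ∈ T K, ν K τ) t)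
          - (cgf (F' K) (∑ τ ∈ T K, ν' K τ) 0 - cgf (F K) (∑ τ ∈ T K, ν K τ) 0))
        - ∫ s in (0 : ℝ)..t, ∑ τ ∈ T K, (Bf K s τ / (∑ σ ∈ T K, Bf K s σ) - A K s τ / (∑ σ ∈ T K, A K s σ)) * tiltedMean (F' K) (ν' K τ) s := by
  have hint := integral_eq_sub_of_hasDerivAt (a := (0 : ℝ)) (b := t) (fun s _ => hasDerivAt_cgf_sub_cgf hA hB K s)
    ((continuous_tiltedMean_total_sub hA hB K).intervalIntegrable 0 t)
  have hsplit : ∀ s : ℝ, ∑ τ ∈ T K, A K s τ / (∑ σ ∈ T K, A K s σ) * (tiltedMean (F' K) (ν' K τ) s - tiltedMean (F K) (ν K τ) s)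
      = (tiltedMean (F' K) (∑ τ ∈ T K, ν' K τ) s - tiltedMean (F K) (∑ τ ∈ T K, ν K τ) s)
        - ∑ τ ∈ T K, (Bf K s τ / (∑ σ ∈ T K, Bf K s σ) - A K s τ / (∑ σ ∈ T K, A K s σ)) * tiltedMean (F' K) (ν' K τ) s :=
    fun s => by rw [avgMismatch_eq_deriv_sub_transport hA hB K (hZA s) (hZB s), (hasDerivAt_cgf_sub_cgf hA hB K s).deriv]
  simp_rw [hsplit]
  rw [intervalIntegral.integral_sub ((continuous_tiltedMean_total_sub hA hB K).intervalIntegrable 0 t)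
    ((continuous_transport hA hB K hZA hZB).intervalIntegrable 0 t), hint]

/-- The integrated transport term costs `2B·ρ_K·|t|` under dag-n20-w4's per-set class-law TV letter on the source window (FILE 1's `abs_transport_le`). [folklore] -/
theorem abs_integral_transport_le [DecidableEq ι] (hB : MGFForm B T F' ν' Bf) (K : ℕ)
    (hρ : ∀ (t : ℝ), |t| ≤ l₀ → ∀ S ⊆ T K,
      |(∑ τ ∈ S, A K t τ) / (∑ τ ∈ T K, A K t τ) - (∑ τ ∈ S, Bf K t τ) / (∑ τ ∈ T K, Bf K t τ)| ≤ ρ K) {t : ℝ} (ht : |t| ≤ l₀) :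
    |∫ s in (0 : ℝ)..t, ∑ τ ∈ T K, (Bf K s τ / (∑ σ ∈ T K, Bf K s σ) - A K s τ / (∑ σ ∈ T K, A K s σ)) * tiltedMean (F' K) (ν' K τ) s|
      ≤ 2 * B * ρ K * |t| := by
  have h := norm_integral_le_of_norm_le_const (a := (0 : ℝ)) (b := t) (C := 2 * B * ρ K)
    (f := fun s => ∑ τ ∈ T K, (Bf K s τ / (∑ σ ∈ T K, Bf K s σ) - A K s τ / (∑ σ ∈ T K, A K s σ)) * tiltedMean (F' K) (ν' K τ) s)
    fun s hs => by
      rw [Real.norm_eq_abs]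
      have hs' : |s| ≤ l₀ := by
        rcases Set.mem_uIoc.mp hs with ⟨h1, h2⟩ | ⟨h1, h2⟩
        · exact (abs_le.mpr ⟨by linarith [abs_nonneg t], by linarith [le_abs_self t]⟩).trans ht
        · exact (abs_le.mpr ⟨by linarith [neg_abs_le t], by linarith [abs_nonneg t]⟩).trans ht
      exact abs_transport_le (T K) _ _ _ hB.nonneg (fun τ _ => abs_tiltedMean_le (hB.bound K) hB.nonneg s) (hρ s hs')
  rw [Real.norm_eq_abs, sub_zero] at h
  exact h

/-! ## §3 Necessity: ANY six dials bound the integrated class-averaged N14 mismatch summably -/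

/-- One level, pinned: if `log Z_{K+1} − log Z_K` stays within `e` of a constant on the source window and the class laws satisfy dag-n20-w4's per-set TV letter with
radius `ρ_K`, then `|∫₀ᵗ Σ_T p_s·(m′_s − m_s) ds| ≤ 2e + 2B·l₀·ρ_K` for `|t| ≤ l₀`. [folklore] -/
theorem abs_integral_avgMismatch_le_of_pinned [DecidableEq ι] (hA : MGFForm B T F ν A) (hB : MGFForm B T F' ν' Bf) (K : ℕ)
    (hZA : ∀ s : ℝ, 0 < ∑ σ ∈ T K, A K s σ) (hZB : ∀ s : ℝ, 0 < ∑ σ ∈ T K, Bf K s σ)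
    (hZA' : ∀ (K : ℕ) (t : ℝ), |t| ≤ l₀ → Z K t = ∑ τ ∈ T K, A K t τ)
    (hZB' : ∀ (K : ℕ) (t : ℝ), |t| ≤ l₀ → Z (K + 1) t = ∑ τ ∈ T K, Bf K t τ)
    (hρ : ∀ (t : ℝ), |t| ≤ l₀ → ∀ S ⊆ T K,
      |(∑ τ ∈ S, A K t τ) / (∑ τ ∈ T K, A K t τ) - (∑ τ ∈ S, Bf K t τ) / (∑ τ ∈ T K, Bf K t τ)| ≤ ρ K)
    {c e : ℝ} (hc : ∀ t : ℝ, |t| ≤ l₀ → |Real.log (Z (K + 1) t) - Real.log (Z K t) - c| ≤ e) {t : ℝ} (ht : |t| ≤ l₀) :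
    |∫ s in (0 : ℝ)..t, ∑ τ ∈ T K, A K s τ / (∑ σ ∈ T K, A K s σ) * (tiltedMean (F' K) (ν' K τ) s - tiltedMean (F K) (ν K τ) s)|
      ≤ 2 * e + 2 * B * l₀ * ρ K := by
  have hl₀ : 0 ≤ l₀ := (abs_nonneg t).trans ht
  have h0 : |(0 : ℝ)| ≤ l₀ := by rw [abs_zero]; exact hl₀
  rw [integral_avgMismatch_eq hA hB K hZA hZB t, ← log_eq_cgf_finsetSum hB hZB' K ht, ← log_eq_cgf_finsetSum hA hZA' K ht,
    ← log_eq_cgf_finsetSum hB hZB' K h0, ← log_eq_cgf_finsetSum hA hZA' K h0]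
  set X := Real.log (Z (K + 1) t) - Real.log (Z K t)
  set Y := Real.log (Z (K + 1) 0) - Real.log (Z K 0)
  set I := ∫ s in (0 : ℝ)..t, ∑ τ ∈ T K, (Bf K s τ / (∑ σ ∈ T K, Bf K s σ) - A K s τ / (∑ σ ∈ T K, A K s σ)) * tiltedMean (F' K) (ν' K τ) s
  have hI : |I| ≤ 2 * B * ρ K * |t| := abs_integral_transport_le hB K hρ ht
  have hρ0 : 0 ≤ ρ K := by have h := hρ t ht ∅ (Finset.empty_subset _); simpa using h
  have h2 : 0 ≤ 2 * B * ρ K := by have := hB.nonneg; positivity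
  have hXY : |X - Y| ≤ e + e := by
    rw [show X - Y = (X - c) - (Y - c) by ring]
    exact (abs_sub _ _).trans (add_le_add (hc t ht) (hc 0 h0))
  calc |X - Y - I| ≤ |X - Y| + |I| := abs_sub _ _
    _ ≤ (e + e) + 2 * B * ρ K * |t| := add_le_add hXY hI
    _ ≤ (e + e) + 2 * B * ρ K * l₀ := by gcongr
    _ = 2 * e + 2 * B * l₀ * ρ K := by ring

/-- ★★ **NECESSITY.**  If the two MGF-form runs carry `HybridNE7 l₀ vol T A Bf Bad W shA shB Wsh δ` for SOME six dials (dictionary + positivity as in `HybridNE7.cauchy`),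
then there are summable `ρ ≥ 0` (dag-n20-w4's TV budget, `exists_tvRadius_of_hybridNE7`) and `δ′` (`Spine.NE7.target_of_hybridNE7`) with
`|∫₀ᵗ Σ_T p_s·(m′_s − m_s) ds| ≤ 2·vol·δ′_K + 2B·l₀·ρ_K` for every `K` and `|t| ≤ l₀`: the hybrid binder list forces N14's binder to be summably small in class-averaged,
source-integrated form. [folklore] -/
theorem integral_avgMismatch_le_of_hybridNE7 [DecidableEq ι] {Bad : ℕ → ℝ → Finset ι} {W Wsh δ : ℕ → ℝ} {shA shB : ℕ → ℝ → ι → ℝ}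
    (h : HybridNE7 l₀ vol T A Bf Bad W shA shB Wsh δ) (hvol : 0 < vol) (hl₀ : 0 ≤ l₀) (hA : MGFForm B T F ν A) (hB : MGFForm B T F' ν' Bf)
    (hZA : ∀ (K : ℕ) (t : ℝ), 0 < ∑ τ ∈ T K, A K t τ) (hZB : ∀ (K : ℕ) (t : ℝ), 0 < ∑ τ ∈ T K, Bf K t τ)
    (hZA' : ∀ (K : ℕ) (t : ℝ), |t| ≤ l₀ → Z K t = ∑ τ ∈ T K, A K t τ)
    (hZB' : ∀ (K : ℕ) (t : ℝ), |t| ≤ l₀ → Z (K + 1) t = ∑ τ ∈ T K, Bf K t τ) :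
    ∃ ρ δ' : ℕ → ℝ, (∀ K, 0 ≤ ρ K) ∧ Summable ρ ∧ Summable δ' ∧ ∀ (K : ℕ) (t : ℝ), |t| ≤ l₀ →
      |∫ s in (0 : ℝ)..t, ∑ τ ∈ T K, A K s τ / (∑ σ ∈ T K, A K s σ) * (tiltedMean (F' K) (ν' K τ) s - tiltedMean (F K) (ν K τ) s)|
        ≤ 2 * vol * δ' K + 2 * B * l₀ * ρ K := by
  obtain ⟨ρ, hρ01, hρs, hρ⟩ := exists_tvRadius_of_hybridNE7 h (fun K t _ => hZA K t) (fun K t _ => hZB K t)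
  obtain ⟨hMMC, hDs⟩ := target_of_hybridNE7 h hvol hl₀ hZA' hZB' (fun K t _ => hZA K t)
  refine ⟨ρ, _, fun K => (hρ01 K).1, hρs, hDs, fun K t ht => ?_⟩
  obtain ⟨c, hc⟩ := hMMC K
  have key := abs_integral_avgMismatch_le_of_pinned hA hB K (hZA K) (hZB K) hZA' hZB' (hρ K) hc ht
  linarith [key]

/-! ## §4 Sufficiency: the integrated class-averaged N14 mismatch and the class-law TV give `MatchingModConstants`, `Target`, the `∃`-hybrid -/

/-- ★★ **`MatchingModConstants` FROM THE INTEGRATED AVERAGED BINDER AND THE CLASS-LAW TV**, `vol·δ_K = r_K + 2B·l₀·ρ_K`; NO bad-class split (the average runs over all classes). [folklore] -/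
theorem matchingModConstants_of_integral_avgMismatch_of_classLawTV [DecidableEq ι] (hA : MGFForm B T F ν A) (hB : MGFForm B T F' ν' Bf)
    (hr : ∀ (K : ℕ) (t : ℝ), |t| ≤ l₀ →
      |∫ s in (0 : ℝ)..t, ∑ τ ∈ T K, A K s τ / (∑ σ ∈ T K, A K s σ) * (tiltedMean (F' K) (ν' K τ) s - tiltedMean (F K) (ν K τ) s)| ≤ r K)
    (hρ : ∀ (K : ℕ) (t : ℝ), |t| ≤ l₀ → ∀ S ⊆ T K,
      |(∑ τ ∈ S, A K t τ) / (∑ τ ∈ T K, A K t τ) - (∑ τ ∈ S, Bf K t τ) / (∑ τ ∈ T K, Bf K t τ)| ≤ ρ K)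
    (hZA : ∀ (K : ℕ) (t : ℝ), 0 < ∑ τ ∈ T K, A K t τ) (hZB : ∀ (K : ℕ) (t : ℝ), 0 < ∑ τ ∈ T K, Bf K t τ)
    (hZA' : ∀ (K : ℕ) (t : ℝ), |t| ≤ l₀ → Z K t = ∑ τ ∈ T K, A K t τ)
    (hZB' : ∀ (K : ℕ) (t : ℝ), |t| ≤ l₀ → Z (K + 1) t = ∑ τ ∈ T K, Bf K t τ)
    {δ : ℕ → ℝ} (hw : ∀ K, r K + 2 * B * l₀ * ρ K ≤ vol * δ K) : MatchingModConstants vol l₀ δ Z := by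
  intro K
  refine ⟨cgf (F' K) (∑ τ ∈ T K, ν' K τ) 0 - cgf (F K) (∑ τ ∈ T K, ν K τ) 0, fun t ht => ?_⟩
  have hl₀ : 0 ≤ l₀ := (abs_nonneg t).trans ht
  have hI := integral_avgMismatch_eq hA hB K (hZA K) (hZB K) t
  have htr := abs_integral_transport_le hB K (hρ K) ht
  have hrK := hr K t ht
  rw [log_eq_cgf_finsetSum hB hZB' K ht, log_eq_cgf_finsetSum hA hZA' K ht]
  have hρ0 : 0 ≤ ρ K := by have h := hρ K t ht ∅ (Finset.empty_subset _); simpa using h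
  -- `(D t − D 0) = ∫avgM + ∫transport`
  have hD : cgf (F' K) (∑ τ ∈ T K, ν' K τ) t - cgf (F K) (∑ τ ∈ T K, ν K τ) t
        - (cgf (F' K) (∑ τ ∈ T K, ν' K τ) 0 - cgf (F K) (∑ τ ∈ T K, ν K τ) 0)
      = (∫ s in (0 : ℝ)..t, ∑ τ ∈ T K, A K s τ / (∑ σ ∈ T K, A K s σ) * (tiltedMean (F' K) (ν' K τ) s - tiltedMean (F K) (ν K τ) s))
        + ∫ s in (0 : ℝ)..t, ∑ τ ∈ T K, (Bf K s τ / (∑ σ ∈ T K, Bf K s σ) - A K s τ / (∑ σ ∈ T K, A K s σ)) * tiltedMean (F' K) (ν' K τ) s := by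
    rw [hI]; ring
  rw [hD]
  have h2 : 0 ≤ 2 * B * ρ K := by have := hB.nonneg; positivity
  calc _ ≤ r K + 2 * B * ρ K * |t| := (abs_add_le _ _).trans (add_le_add hrK htr)
    _ ≤ r K + 2 * B * ρ K * l₀ := by gcongr
    _ ≤ vol * δ K := by linarith [hw K]

/-- ★★ **THE `∃`-HYBRID FROM THE INTEGRATED AVERAGED BINDER AND THE CLASS-LAW TV** (dag-n20-w4's `exists_hybridNE7_of_target_of_classLawTV` BY NAME), `Bad = ∅`, `W = 0`,
`δ_K = (r_K + 2B·l₀·ρ_K)∕vol`. [folklore] -/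
theorem exists_hybridNE7_of_integral_avgMismatch_of_classLawTV [DecidableEq ι] (hl₀ : 0 ≤ l₀) (hvol : 0 < vol) (hA : MGFForm B T F ν A)
    (hB : MGFForm B T F' ν' Bf)
    (hr : ∀ (K : ℕ) (t : ℝ), |t| ≤ l₀ →
      |∫ s in (0 : ℝ)..t, ∑ τ ∈ T K, A K s τ / (∑ σ ∈ T K, A K s σ) * (tiltedMean (F' K) (ν' K τ) s - tiltedMean (F K) (ν K τ) s)| ≤ r K)
    (hrs : Summable r) (hρ0 : ∀ K, 0 ≤ ρ K) (hρ1 : ∀ K, ρ K < 1) (hρs : Summable ρ)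
    (hρ : ∀ (K : ℕ) (t : ℝ), |t| ≤ l₀ → ∀ S ⊆ T K,
      |(∑ τ ∈ S, A K t τ) / (∑ τ ∈ T K, A K t τ) - (∑ τ ∈ S, Bf K t τ) / (∑ τ ∈ T K, Bf K t τ)| ≤ ρ K)
    (hZA : ∀ (K : ℕ) (t : ℝ), 0 < ∑ τ ∈ T K, A K t τ) (hZB : ∀ (K : ℕ) (t : ℝ), 0 < ∑ τ ∈ T K, Bf K t τ)
    (hZA' : ∀ (K : ℕ) (t : ℝ), |t| ≤ l₀ → Z K t = ∑ τ ∈ T K, A K t τ)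
    (hZB' : ∀ (K : ℕ) (t : ℝ), |t| ≤ l₀ → Z (K + 1) t = ∑ τ ∈ T K, Bf K t τ) :
    ∃ shA shB : ℕ → ℝ → ι → ℝ,
      HybridNE7 l₀ vol T A Bf (fun _ _ => ∅) (fun _ => 0) shA shB ρ (fun K => (r K + 2 * B * l₀ * ρ K) / vol) := by
  have hT : Target vol l₀ (fun K => (r K + 2 * B * l₀ * ρ K) / vol) Z :=
    ⟨matchingModConstants_of_integral_avgMismatch_of_classLawTV hA hB hr hρ hZA hZB hZA' hZB' fun K => by rw [mul_div_cancel₀ _ hvol.ne'],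
      (hrs.add (hρs.mul_left (2 * B * l₀))).div_const vol⟩
  exact exists_hybridNE7_of_target_of_classLawTV hl₀ (fun K t _ _ hτ => hA.nonneg' K t hτ) (fun K t _ _ hτ => hB.nonneg' K t hτ)
    (fun K t _ => hZA K t) (fun K t _ => hZB K t) hZA' hZB' hT hρ0 hρ1 hρs hρ

/-! ## §5 The characterisation re-keyed -/

/-- ★★★ **dag-n20-w4's CHARACTERISATION RE-KEYED — THE TARGET CONJUNCT REPLACED BY NODE N14's CLASS-AVERAGED, SOURCE-INTEGRATED BINDER.**  Two MGF-form runs on one class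
family (`DressedMGFForm.MGFForm`), positive dressed totals, the dictionary `Z K = Σ_T A K`, `Z (K+1) = Σ_T Bf K` on the window, `0 ≤ l₀`, `0 < vol`.  THEN
`(∃ Bad W shA shB Wsh δ, HybridNE7 l₀ vol T A Bf Bad W shA shB Wsh δ)` IFF [dag-n20-w4's summable per-set class-law TV radius `0 ≤ ρ_K < 1`] AND [a summable `r` with
`|∫₀ᵗ Σ_T (A K s ∕ Σ_T A K s)·(tiltedMean (F′ K)(ν′ K τ) s − tiltedMean (F K)(ν K τ) s) ds| ≤ r_K` for all `|t| ≤ l₀`] — compare p609004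
`exists_hybridNE7_iff_target_and_classLawTV`, whose first conjunct `∃ δ, Target vol l₀ δ Z` is here replaced by a statement about node N14's objects only. [folklore] -/
theorem exists_hybridNE7_iff_classLawTV_and_integral_avgMismatch [DecidableEq ι] (hl₀ : 0 ≤ l₀) (hvol : 0 < vol) (hA : MGFForm B T F ν A)
    (hB : MGFForm B T F' ν' Bf) (hZA : ∀ (K : ℕ) (t : ℝ), 0 < ∑ τ ∈ T K, A K t τ) (hZB : ∀ (K : ℕ) (t : ℝ), 0 < ∑ τ ∈ T K, Bf K t τ)
    (hZA' : ∀ (K : ℕ) (t : ℝ), |t| ≤ l₀ → Z K t = ∑ τ ∈ T K, A K t τ)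
    (hZB' : ∀ (K : ℕ) (t : ℝ), |t| ≤ l₀ → Z (K + 1) t = ∑ τ ∈ T K, Bf K t τ) :
    (∃ (Bad : ℕ → ℝ → Finset ι) (W : ℕ → ℝ) (shA shB : ℕ → ℝ → ι → ℝ) (Wsh δ : ℕ → ℝ), HybridNE7 l₀ vol T A Bf Bad W shA shB Wsh δ) ↔
      ((∃ ρ : ℕ → ℝ, (∀ K, 0 ≤ ρ K ∧ ρ K < 1) ∧ Summable ρ ∧
          ∀ (K : ℕ) (t : ℝ), |t| ≤ l₀ → ∀ S ⊆ T K,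
            |(∑ τ ∈ S, A K t τ) / (∑ τ ∈ T K, A K t τ) - (∑ τ ∈ S, Bf K t τ) / (∑ τ ∈ T K, Bf K t τ)| ≤ ρ K) ∧
        ∃ r : ℕ → ℝ, Summable r ∧ ∀ (K : ℕ) (t : ℝ), |t| ≤ l₀ →
          |∫ s in (0 : ℝ)..t, ∑ τ ∈ T K, A K s τ / (∑ σ ∈ T K, A K s σ) * (tiltedMean (F' K) (ν' K τ) s - tiltedMean (F K) (ν K τ) s)|
            ≤ r K) := by
  constructor
  · rintro ⟨Bad, W, shA, shB, Wsh, δ, h⟩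
    obtain ⟨ρ, hρ01, hρs, hρ⟩ := exists_tvRadius_of_hybridNE7 h (fun K t _ => hZA K t) (fun K t _ => hZB K t)
    obtain ⟨ρ', δ', hρ'0, hρ's, hδ's, hI⟩ := integral_avgMismatch_le_of_hybridNE7 h hvol hl₀ hA hB hZA hZB hZA' hZB'
    exact ⟨⟨ρ, hρ01, hρs, hρ⟩, ⟨fun K => 2 * vol * δ' K + 2 * B * l₀ * ρ' K, (hδ's.mul_left (2 * vol)).add (hρ's.mul_left (2 * B * l₀)), hI⟩⟩
  · rintro ⟨⟨ρ, hρ01, hρs, hρ⟩, ⟨r, hrs, hr⟩⟩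
    obtain ⟨shA, shB, h⟩ := exists_hybridNE7_of_integral_avgMismatch_of_classLawTV hl₀ hvol hA hB hr hrs (fun K => (hρ01 K).1)
      (fun K => (hρ01 K).2) hρs hρ hZA hZB hZA' hZB'
    exact ⟨_, _, shA, shB, _, _, h⟩

end AtForms

end YMDAG.N14.HybridIffClassLawTVAndBinder

end
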